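import Literature.NumberTheory.DiophantineGeometry.AbcDepthCensusTurboSym

/-!
# A certified census of abc triples by 5-depth in boxes `c ≤ N` — mixed covers (empty chunks + a member list)

Seventh layer.  When a deep cell is censused chunk by chunk with the always-failing test (`fun _ _ _ => false`:
"no lattice candidate at all") and ONE chunk turns out to hold candidates, the accepted empty chunks need not
be re-run with another test: a chunk accepted with the always-failing test holds no abc triple of the cell at
all, whatever one wants to test.  `members_complete_of_mixed` makes this precise for the symmetric turbo
checker: if every chunk of a cover is accepted EITHER with the always-failing test OR with the member test
of a list `Lm` (read in both orientations), then every abc triple of the cell `{ω₅ ≥ K}` in the box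
`{c ≤ N}` is listed in `Lm`.  (Used for the first member of the cell `ω₅ ≥ 9`: twelve chunks of the box
`10¹⁹` are empty, the thirteenth holds exactly one triple.)

No axiom beyond `propext`, `Classical.choice`, `Quot.sound`.  Source: this project; finite computations.
-/

namespace Literature.NumberTheory.DiophantineGeometry.DepthCensus

/-- The member test of a list, read in both orientations. [folklore] -/
def memberTest (Lm : List (ℕ × ℕ × ℕ)) (a b c : ℕ) : Bool :=
  !(Nat.gcd a b == 1) || (Lm.elem (a, b, c) || Lm.elem (b, a, c))

/-- `memberTest` is symmetric in `a, b`. [folklore] -/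
theorem memberTest_symm' (Lm : List (ℕ × ℕ × ℕ)) (a b c : ℕ) :
    memberTest Lm a b c = memberTest Lm b a c := by
  unfold memberTest
  rw [Nat.gcd_comm, Bool.or_comm (Lm.elem (a, b, c))]

/-- Every pattern of the cell is accepted by the guarded walk of SOME accepted chunk: with the always-failing
test or with the member test. [folklore] -/
theorem forall_patterns_of_mixed {N R K : ℕ} {Lm : List (ℕ × ℕ × ℕ)} {S : List (List (Fin 4))} {d : ℕ}
    (hS : coversAll S d = true)
    (h : ∀ s ∈ S, checkTurboChunkSym N R K s (fun _ _ _ => false) = true ∨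
      checkTurboChunkSym N R K s (memberTest Lm) = true) :
    ∀ t ∈ patterns N (deepPrimes N R) K 1 1 1,
      loopTurboSym N t.1 t.2.1 t.2.2 (fun _ _ _ => false) = true ∨
        loopTurboSym N t.1 t.2.1 t.2.2 (memberTest Lm) = true := by
  intro t ht
  obtain ⟨s, hs, hts⟩ := exists_mem_followPrefix_of_coversAll hS ht
  rw [← turboTable_map_fst N R K] at hts
  have hok := turboTable_ok N R K
  have hsort : ((turboTable N R K).map Prod.fst).Pairwise (· ≤ ·) := by
    rw [turboTable_map_fst]; exact deepPrimes_sorted N R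
  have hpos : ∀ e ∈ turboTable N R K, 0 < e.1 := fun e he => by
    simp only [turboTable, List.mem_map] at he
    obtain ⟨p, hp, rfl⟩ := he
    exact (mem_deepPrimes.mp hp).2.1.pos
  rcases h s hs with hrun | hrun
  · exact Or.inl (turboFollow_sound N K (fun A B C => loopTurboSym N A B C (fun _ _ _ => false)) s
      (turboTable N R K) K 1 1 1 1 hok hsort hpos le_rfl (by ring) hrun t hts)
  · exact Or.inr (turboFollow_sound N K (fun A B C => loopTurboSym N A B C (memberTest Lm)) s
      (turboTable N R K) K 1 1 1 1 hok hsort hpos le_rfl (by ring) hrun t hts)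

/-- **Members from a mixed cover.** If `N < (R+1)⁵`, `S` covers some depth `d`, and every chunk named in
`S` is accepted either with the always-failing test or with the member test of `Lm`, then every abc triple
with `c ≤ N` and `ω₅(abc) ≥ K` is listed in `Lm`, in one of the two orientations. [folklore] -/
theorem members_complete_of_mixed {N R K : ℕ} {Lm : List (ℕ × ℕ × ℕ)} (hR : N < (R + 1) ^ 5)
    {S : List (List (Fin 4))} {d : ℕ} (hS : coversAll S d = true)
    (h : ∀ s ∈ S, checkTurboChunkSym N R K s (fun _ _ _ => false) = true ∨
      checkTurboChunkSym N R K s (memberTest Lm) = true)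
    {a b c : ℕ} (habc : IsABCTriple a b c) (hcN : c ≤ N)
    (hK : K ≤ ((a * b * c).primeFactors.filter (fun p => 5 ≤ (a * b * c).factorization p)).card) :
    (a, b, c) ∈ Lm ∨ (b, a, c) ∈ Lm := by
  have hall := forall_patterns_of_mixed (Lm := Lm) hS h
  obtain ⟨A, B, C, hmem, hmem', hA0, hB0, hC0, hA, hB, hC⟩ :=
    exists_pattern_and_mirror hR habc hcN hK
  have hcop : Nat.gcd a b = 1 := habc.2.2.2
  obtain ⟨ha, hb, hsum, -⟩ := habc
  -- the member test on the triple, in either orientation, gives the listing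
  have key : ∀ {x y : ℕ}, memberTest Lm x y c = true → Nat.gcd x y = 1 →
      (x, y, c) ∈ Lm ∨ (y, x, c) ∈ Lm := by
    intro x y hm hg
    unfold memberTest at hm
    simp only [hg, beq_self_eq_true, Bool.not_true, Bool.false_or, Bool.or_eq_true] at hm
    rcases hm with h1 | h1
    · exact Or.inl (List.mem_of_elem_eq_true h1)
    · exact Or.inr (List.mem_of_elem_eq_true h1)
  by_cases hlt : B < A
  · -- use the mirror pattern on the mirror triple
    rcases hall _ hmem' with hrun | hrun
    · simp only [loopTurboSym, if_neg (lt_asymm hlt)] at hrun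
      exact absurd (loopTurbo_sound hB0 hA0 hC0 hrun hB hA hC hb ha (by omega) hcN) Bool.false_ne_true
    · simp only [loopTurboSym, if_neg (lt_asymm hlt)] at hrun
      have hm := loopTurbo_sound hB0 hA0 hC0 hrun hB hA hC hb ha (by omega) hcN
      rcases key hm (by rw [Nat.gcd_comm]; exact hcop) with h1 | h1
      · exact Or.inr h1
      · exact Or.inl h1
  · rcases hall _ hmem with hrun | hrun
    · simp only [loopTurboSym, if_neg hlt] at hrun
      exact absurd (loopTurbo_sound hA0 hB0 hC0 hrun hA hB hC ha hb hsum hcN) Bool.false_ne_true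
    · simp only [loopTurboSym, if_neg hlt] at hrun
      exact key (loopTurbo_sound hA0 hB0 hC0 hrun hA hB hC ha hb hsum hcN) hcop

end Literature.NumberTheory.DiophantineGeometry.DepthCensus
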